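import Literature.Probability.Percolation.SlabRSWGluingCore
import HarnessLib

/-!
# Newman–Tassion–Wu 2017, §3.2 — the gluing lemmas for slabs: the surgery ending in the target set

Topic: `Literature/Probability/Percolation`. Variant of the geometry-free core
`SlabRSWGluingCore.lean` of the local surgery of NTW's main gluing lemma (Thm. 3.7): there the
rerouted minimal path re-joins `Γ = Γ_min^S(A,B)` at its last vertex `E₂` over the cleared set and
continues along `Γ` to `B̄` (so the cleared set must avoid `B`, and `Γ`'s last vertex must lie
outside it). When the contact happens NEAR THE TARGET SET `B` — unavoidable when `B` is a proper
segment of a side of the rectangle, as in all of §3.3 (`X`, `Y`, `Z_i`) — the cleared box contains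
vertices of `B̄`, and the natural rerouting ENDS the trunk at a vertex `β ∈ B̄` inside the cleared
set: the new minimal path is then exactly `p₀ ++ E₁ :: P ++ [β]` (no continuation), and the
recovery argument simplifies. This file is that variant:

* `GlueData.SurgeryB Q k ω` — data: cleared `D ⊆ R ∖ A` (cells of `B` allowed); `Γ = p₀ ++ E₁ ::
  rest` at the first visit `E₁` of `D̄` (`p₀ ≠ []` off `D̄`, `rest ≠ []`); trunk `E₁ :: P ++ [β]` with
  `P ⊆ D̄ ∩ S̄ ∖ B̄` and `β ∈ D̄ ∩ S̄ ∩ B̄`; junction, branch, port vertex and far side as in `Surgery`.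
* PROVED: `γ_newConfig_eq` (`Γ_min(ω') = p₀ ++ E₁ :: P ++ [β]`), `c_mem_att`, `att_subset`,
  `newConfig_mem_evCA`, locality `agree_off_touch`.

## Sources

* C. M. Newman, V. Tassion, W. Wu, *Critical percolation and the minimal spanning tree in slabs*,
  Comm. Pure Appl. Math. 70 (2017), arXiv:1512.09107: §3.2, proof of Theorem 3.7, steps (1)–(3)
  and the recovery sentence ("if `z = v`, we take `v = v′ = z`": the rerouted path may end at the
  modification) [NewmanTassionWu2017].
-/

noncomputable section

namespace Literature.Probability.Percolation

open MeasureTheory LatticeModels SimpleGraph Filter Topology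

namespace NTW17

/-! ## The data of one surgery ending in `B̄` -/

section SurgeryData

variable (k : ℕ)

/-- **The data of one local surgery whose trunk ends in the target set** (NTW 2017, proof of
Thm. 3.7, steps (1)–(3), near `B`). For `ω ∈ evX` with `γ = p₀ ++ E₁ :: rest`: a cleared planar set
`D ⊆ R` avoiding `A`, met by `γ` first at `E₁` (`p₀ ≠ []` off `D̄`, `rest ≠ []`); a rerouted piece
`P` inside `D̄ ∩ S̄` off `B̄` and an end vertex `β` over `D ∩ S ∩ B`, with `E₁ :: P ++ [β]` a
self-avoiding lattice chain; a junction `c ∈ E₁ :: P`; a branch `Br ⊆ D̄` and a port vertex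
`q₁ ∉ D̄` with `c :: Br ++ [q₁]` a self-avoiding lattice chain meeting the trunk only at `c`; the
forward condition; and an `ω`-open path from `q₁` to `cC ∈ C̄` inside `R̄ ∖ D̄`.
[cite: NewmanTassionWu2017, §3.2 (proof of Theorem 3.7, steps (1)–(3))] -/
structure GlueData.SurgeryB (Q : GlueData) (ω : BondConfig (slab 3 k)) where
  /-- the cleared columns -/
  D : Set (ℤ × ℤ)
  /-- `γ` before its first visit to `D̄` -/
  p₀ : List (slab 3 k)
  /-- the first vertex of `γ` in `D̄` -/
  E₁ : slab 3 k
  /-- `γ` after `E₁` -/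
  rest : List (slab 3 k)
  /-- the rerouted piece (strictly between `E₁` and `β`) -/
  P : List (slab 3 k)
  /-- the end of the trunk, over `B` -/
  β : slab 3 k
  /-- the junction -/
  c : slab 3 k
  /-- the branch (inside `D̄`, possibly empty) -/
  Br : List (slab 3 k)
  /-- the port vertex (outside `D̄`) -/
  q₁ : slab 3 k
  /-- the far vertex, in `C̄` -/
  cC : slab 3 k
  hDR : D ⊆ Q.R
  hDA : ∀ z ∈ D, z ∉ Q.A
  hγ : Q.γ k ω = p₀ ++ E₁ :: rest
  hp₀ : p₀ ≠ []
  hrest : rest ≠ []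
  hp₀D : ∀ x ∈ p₀, planar k x ∉ D
  hE₁D : planar k E₁ ∈ D
  hPD : ∀ x ∈ P, planar k x ∈ D
  hPS : ∀ x ∈ P, planar k x ∈ Q.S
  hPB : ∀ x ∈ P, planar k x ∉ Q.B
  hβD : planar k β ∈ D
  hβS : planar k β ∈ Q.S
  hβB : planar k β ∈ Q.B
  hSPchain : (E₁ :: (P ++ [β])).IsChain (fun a b => (slabGraph 3 k).Adj a b)
  hSPnodup : (E₁ :: (P ++ [β])).Nodup
  hc : c ∈ E₁ :: P
  hBrD : ∀ x ∈ Br, planar k x ∈ D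
  hq₁D : planar k q₁ ∉ D
  hBchain : (c :: (Br ++ [q₁])).IsChain (fun a b => (slabGraph 3 k).Adj a b)
  hBnodup : (c :: (Br ++ [q₁])).Nodup
  hBrSP : ∀ x ∈ Br, x ∉ E₁ :: (P ++ [β])
  hfwd : ∀ (l₁ l₂ : List (slab 3 k)) (y : slab 3 k), E₁ :: (P ++ [β]) = l₁ ++ c :: y :: l₂ →
    vKey k y < vKey k ((Br ++ [q₁]).head (by simp))
  hcC : cC ∈ slabLift k Q.C
  hσ : ω ∈ openConnIn (slabLift k (Q.R \ D)) q₁ cC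

namespace GlueData.SurgeryB

variable {k} {Q : GlueData} {ω : BondConfig (slab 3 k)} (sb : Q.SurgeryB k ω)

/-- The trunk `E₁ :: P ++ [β]`. [cite: NewmanTassionWu2017, §3.2 (proof of Theorem 3.7, step (3))] -/
def SP : List (slab 3 k) := sb.E₁ :: (sb.P ++ [sb.β])

/-- The branch followed by the port vertex. [cite: NewmanTassionWu2017, §3.2 (proof of Theorem 3.7, step (3), the path γ_w)] -/
def BQ : List (slab 3 k) := sb.Br ++ [sb.q₁]

/-- The new (opened) edges: those of the trunk and of the branch with its port edge.
[cite: NewmanTassionWu2017, §3.2 (proof of Theorem 3.7, step (3) "Open the edges …")] -/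
def structEdges : Set (Sym2 (slab 3 k)) := edgesOf sb.SP ∪ edgesOf (sb.c :: sb.BQ)

/-- The kept edge of `γ` entering `D̄` (into `E₁`).
[cite: NewmanTassionWu2017, §3.2 (proof of Theorem 3.7, step (2) "except the edges … which are in Γ(ω)")] -/
def stubs : Set (Sym2 (slab 3 k)) := {s(sb.p₀.getLast sb.hp₀, sb.E₁)}

/-- **The new configuration**: close every pair touching `D̄`, then open the structure edges and
the stub. [cite: NewmanTassionWu2017, §3.2 (proof of Theorem 3.7, steps (2)–(3))] -/
def newConfig : BondConfig (slab 3 k) := (ω \ touch k sb.D) ∪ sb.structEdges ∪ sb.stubs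

/-- The protected structure vertices: the trunk and the branch.
[cite: NewmanTassionWu2017, §3.2 (proof of Theorem 3.7)] -/
def Wv : Set (slab 3 k) := {x | x ∈ sb.SP ∨ x ∈ sb.Br}

/-- All structure vertices: the protected ones and the port vertex.
[cite: NewmanTassionWu2017, §3.2 (proof of Theorem 3.7)] -/
def Sw : Set (slab 3 k) := {x | x ∈ sb.Wv ∨ x = sb.q₁}

/-! ### Elementary consequences of the data -/

/-- `BQ ≠ []`. [cite: NewmanTassionWu2017, §3.2 (proof of Theorem 3.7)] -/
theorem BQ_ne_nil : sb.BQ ≠ [] := by simp [BQ]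

/-- `Wv ⊆ Sw`. [cite: NewmanTassionWu2017, §3.2 (proof of Theorem 3.7)] -/
theorem Wv_subset : sb.Wv ⊆ sb.Sw := fun _ h => Or.inl h

/-- `E₁` lies on the trunk. [cite: NewmanTassionWu2017, §3.2 (proof of Theorem 3.7)] -/
theorem E₁_mem_SP : sb.E₁ ∈ sb.SP := by simp [SP]

/-- `β` lies on the trunk. [cite: NewmanTassionWu2017, §3.2 (proof of Theorem 3.7)] -/
theorem β_mem_SP : sb.β ∈ sb.SP := by simp [SP]

/-- `c` lies on the trunk. [cite: NewmanTassionWu2017, §3.2 (proof of Theorem 3.7)] -/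
theorem c_mem_SP : sb.c ∈ sb.SP := by
  rcases List.mem_cons.1 sb.hc with h | h
  · rw [h]; exact sb.E₁_mem_SP
  · simp [SP, h]

/-- Membership in the trunk. [cite: NewmanTassionWu2017, §3.2 (proof of Theorem 3.7)] -/
theorem mem_SP_iff {x : slab 3 k} : x ∈ sb.SP ↔ x = sb.E₁ ∨ x ∈ sb.P ∨ x = sb.β := by
  simp [SP]

/-- The trunk lies in `D̄`. [cite: NewmanTassionWu2017, §3.2 (proof of Theorem 3.7)] -/
theorem SP_D {x : slab 3 k} (hx : x ∈ sb.SP) : planar k x ∈ sb.D := by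
  rcases sb.mem_SP_iff.1 hx with rfl | h | rfl
  · exact sb.hE₁D
  · exact sb.hPD x h
  · exact sb.hβD

/-- Protected vertices lie in `D̄`. [cite: NewmanTassionWu2017, §3.2 (proof of Theorem 3.7)] -/
theorem Wv_D {x : slab 3 k} (hx : x ∈ sb.Wv) : planar k x ∈ sb.D := by
  rcases hx with h | h
  · exact sb.SP_D h
  · exact sb.hBrD x h

/-- The port vertex is not protected. [cite: NewmanTassionWu2017, §3.2 (proof of Theorem 3.7)] -/
theorem q₁_not_Wv : sb.q₁ ∉ sb.Wv := fun h => sb.hq₁D (sb.Wv_D h)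

/-- The port vertex is a structure vertex. [cite: NewmanTassionWu2017, §3.2 (proof of Theorem 3.7)] -/
theorem q₁_mem_Sw : sb.q₁ ∈ sb.Sw := Or.inr rfl

/-- A structure vertex in `D̄` is protected. [cite: NewmanTassionWu2017, §3.2 (proof of Theorem 3.7)] -/
theorem mem_Wv_of_Sw_D {x : slab 3 k} (hx : x ∈ sb.Sw) (hD : planar k x ∈ sb.D) : x ∈ sb.Wv := by
  rcases hx with h | rfl
  · exact h
  · exact absurd hD sb.hq₁D

/-- The junction is not `β`. [cite: NewmanTassionWu2017, §3.2 (proof of Theorem 3.7)] -/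
theorem c_ne_β : sb.c ≠ sb.β := by
  intro h
  have hnd := sb.hSPnodup
  rcases List.mem_cons.1 sb.hc with h1 | h1
  · rw [h1] at h
    rw [h] at hnd
    exact (List.nodup_cons.1 hnd).1 (by simp)
  · rw [h] at h1
    have := (List.nodup_cons.1 hnd).2
    rw [List.nodup_append] at this
    exact this.2.2 _ h1 _ (by simp) rfl

/-- `E₁ ≠ β`. [cite: NewmanTassionWu2017, §3.2 (proof of Theorem 3.7)] -/
theorem E₁_ne_β : sb.E₁ ≠ sb.β := by
  intro h
  have hnd := sb.hSPnodup
  rw [h] at hnd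
  exact (List.nodup_cons.1 hnd).1 (by simp)

/-- The port vertex is off the trunk. [cite: NewmanTassionWu2017, §3.2 (proof of Theorem 3.7)] -/
theorem q₁_not_mem_SP : sb.q₁ ∉ sb.SP := fun h => sb.hq₁D (sb.SP_D h)

/-- Vertices of `BQ` are off the trunk. [cite: NewmanTassionWu2017, §3.2 (proof of Theorem 3.7)] -/
theorem BQ_not_SP {x : slab 3 k} (hx : x ∈ sb.BQ) : x ∉ sb.SP := by
  rcases List.mem_append.1 hx with h | h
  · exact sb.hBrSP x h
  · rw [List.mem_singleton] at h
    rw [h]; exact sb.q₁_not_mem_SP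

/-- `c ∉ BQ`. [cite: NewmanTassionWu2017, §3.2 (proof of Theorem 3.7)] -/
theorem c_not_BQ : sb.c ∉ sb.BQ := fun h => sb.BQ_not_SP h sb.c_mem_SP

/-- The last vertex of `p₀` is off `D̄`. [cite: NewmanTassionWu2017, §3.2 (proof of Theorem 3.7)] -/
theorem p₀_last_not_D : planar k (sb.p₀.getLast sb.hp₀) ∉ sb.D := sb.hp₀D _ (List.getLast_mem _)

/-- The new edges join structure vertices. [cite: NewmanTassionWu2017, §3.2 (proof of Theorem 3.7)] -/
theorem structEdges_Sw {a b : slab 3 k} (h : s(a, b) ∈ sb.structEdges) : a ∈ sb.Sw ∧ b ∈ sb.Sw := by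
  rcases h with h | h
  · obtain ⟨ha, hb⟩ := mem_of_mem_edgesOf h
    exact ⟨Or.inl (Or.inl ha), Or.inl (Or.inl hb)⟩
  · obtain ⟨ha, hb⟩ := mem_of_mem_edgesOf h
    have aux : ∀ x ∈ sb.c :: sb.BQ, x ∈ sb.Sw := by
      intro x hx
      rcases List.mem_cons.1 hx with rfl | hx
      · exact Or.inl (Or.inl sb.c_mem_SP)
      · rcases List.mem_append.1 hx with hx | hx
        · exact Or.inl (Or.inr hx)
        · rw [List.mem_singleton] at hx
          exact Or.inr hx
    exact ⟨aux a ha, aux b hb⟩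

/-- `γ` in decomposed form is an open self-avoiding path. [cite: NewmanTassionWu2017, §3.2 (proof of Theorem 3.7)] -/
theorem γ_isOSAP (hA : ω ∈ Q.evAB k) :
    IsOSAP k ω (slabLift k Q.S) (slabLift k Q.A) (slabLift k Q.B) (sb.p₀ ++ sb.E₁ :: sb.rest) := by
  have := (Q.γ_spec hA).1
  rw [show Q.γ k ω = _ from sb.hγ] at this
  exact this

/-- The edge of `γ` into `E₁` is open. [cite: NewmanTassionWu2017, §3.2 (proof of Theorem 3.7)] -/
theorem γ_rel_p₀_E₁ (hA : ω ∈ Q.evAB k) :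
    s(sb.p₀.getLast sb.hp₀, sb.E₁) ∈ ω ∧ sb.p₀.getLast sb.hp₀ ≠ sb.E₁ := by
  have hch := (sb.γ_isOSAP hA).chain
  exact List.IsChain.rel_getLast_head_of_append hch sb.hp₀ (by simp)

/-- The stub is `ω`-open. [cite: NewmanTassionWu2017, §3.2 (proof of Theorem 3.7)] -/
theorem stubs_subset (hA : ω ∈ Q.evAB k) : sb.stubs ⊆ ω := by
  rintro e rfl
  exact (sb.γ_rel_p₀_E₁ hA).1

/-- The endpoints of the stub. [cite: NewmanTassionWu2017, §3.2 (proof of Theorem 3.7)] -/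
theorem stubs_cases {q x : slab 3 k} (h : s(q, x) ∈ sb.stubs) :
    (x = sb.E₁ ∧ q = sb.p₀.getLast sb.hp₀) ∨ (q = sb.E₁ ∧ x = sb.p₀.getLast sb.hp₀) := by
  rw [stubs, Set.mem_singleton_iff] at h
  rcases Sym2.eq_iff.1 h with ⟨rfl, rfl⟩ | ⟨rfl, rfl⟩
  · exact Or.inl ⟨rfl, rfl⟩
  · exact Or.inr ⟨rfl, rfl⟩

/-- A stub entering a vertex of `D̄` enters `E₁` from the last vertex of `p₀`.
[cite: NewmanTassionWu2017, §3.2 (proof of Theorem 3.7)] -/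
theorem stubs_cases_D {q x : slab 3 k} (h : s(q, x) ∈ sb.stubs) (hx : planar k x ∈ sb.D) :
    x = sb.E₁ ∧ q = sb.p₀.getLast sb.hp₀ := by
  rcases sb.stubs_cases h with h | ⟨-, rfl⟩
  · exact h
  · exact absurd hx sb.p₀_last_not_D

/-- The stub touches `D̄`. [cite: NewmanTassionWu2017, §3.2 (proof of Theorem 3.7)] -/
theorem stubs_touch : sb.stubs ⊆ touch k sb.D := by
  intro e he
  induction e using Sym2.ind with
  | h q x =>
    rcases sb.stubs_cases he with ⟨rfl, -⟩ | ⟨rfl, -⟩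
    · exact mk_mem_touch_iff.2 (Or.inr sb.hE₁D)
    · exact mk_mem_touch_iff.2 (Or.inl sb.hE₁D)

/-- Every structure edge has a protected endpoint. [cite: NewmanTassionWu2017, §3.2 (proof of Theorem 3.7)] -/
theorem structEdges_Wv {a b : slab 3 k} (h : s(a, b) ∈ sb.structEdges) : a ∈ sb.Wv ∨ b ∈ sb.Wv := by
  rcases h with h | h
  · exact Or.inl (Or.inl (mem_of_mem_edgesOf h).1)
  · -- an edge of `c :: Br ++ [q₁]`: two distinct consecutive vertices, not both `q₁`
    obtain ⟨ha, hb⟩ := mem_of_mem_edgesOf h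
    have hab : a ≠ b :=
      ((SimpleGraph.mem_edgeSet (slabGraph 3 k)).1 (edgesOf_subset_edgeSet sb.hBchain h)).ne
    have aux : ∀ x ∈ sb.c :: sb.BQ, x ≠ sb.q₁ → x ∈ sb.Wv := by
      intro x hx hxq
      rcases List.mem_cons.1 hx with rfl | hx
      · exact Or.inl sb.c_mem_SP
      · rcases List.mem_append.1 hx with hx | hx
        · exact Or.inr hx
        · exact absurd (List.mem_singleton.1 hx) hxq
    by_cases haq : a = sb.q₁
    · exact Or.inr (aux b hb fun hbq => hab (haq.trans hbq.symm))
    · exact Or.inl (aux a ha haq)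

/-- Structure edges touch `D̄`. [cite: NewmanTassionWu2017, §3.2 (proof of Theorem 3.7)] -/
theorem structEdges_touch : sb.structEdges ⊆ touch k sb.D := by
  intro e he
  induction e using Sym2.ind with
  | h a b =>
    rcases sb.structEdges_Wv he with h | h
    · exact mk_mem_touch_iff.2 (Or.inl (sb.Wv_D h))
    · exact mk_mem_touch_iff.2 (Or.inr (sb.Wv_D h))

/-- **Locality**: off the pairs touching `D̄`, the new configuration is the old one. [cite: NewmanTassionWu2017, §3.2 (proof of Theorem 3.7)] -/
theorem mem_newConfig_iff_of_not_touch {e : Sym2 (slab 3 k)} (he : e ∉ touch k sb.D) :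
    e ∈ sb.newConfig ↔ e ∈ ω := by
  constructor
  · rintro ((h | h) | h)
    · exact h.1
    · exact absurd (sb.structEdges_touch h) he
    · exact absurd (sb.stubs_touch h) he
  · exact fun h => Or.inl (Or.inl ⟨h, he⟩)

/-- An old open edge between vertices off `D̄` stays open. [cite: NewmanTassionWu2017, §3.2 (proof of Theorem 3.7)] -/
theorem mem_newConfig_of_off {a b : slab 3 k} (hab : s(a, b) ∈ ω) (ha : planar k a ∉ sb.D)
    (hb : planar k b ∉ sb.D) : s(a, b) ∈ sb.newConfig :=
  (sb.mem_newConfig_iff_of_not_touch (by simp [ha, hb])).2 hab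

/-- `ω' ⊆ ω ∪ Enew`. [cite: NewmanTassionWu2017, §3.2 (proof of Theorem 3.7)] -/
theorem newConfig_subset (hA : ω ∈ Q.evAB k) : sb.newConfig ⊆ ω ∪ sb.structEdges := by
  rintro e ((h | h) | h)
  · exact Or.inl h.1
  · exact Or.inr h
  · exact Or.inl (sb.stubs_subset hA h)

/-- The new configuration is a lattice configuration. [cite: NewmanTassionWu2017, §3.2 (proof of Theorem 3.7)] -/
theorem newConfig_lattice (hω : ω ⊆ (slabGraph 3 k).edgeSet) (hA : ω ∈ Q.evAB k) :
    sb.newConfig ⊆ (slabGraph 3 k).edgeSet := by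
  intro e he
  rcases sb.newConfig_subset hA he with h | (h | h)
  · exact hω h
  · exact edgesOf_subset_edgeSet sb.hSPchain h
  · exact edgesOf_subset_edgeSet sb.hBchain h

/-- Structure edges are open in the new configuration. [cite: NewmanTassionWu2017, §3.2 (proof of Theorem 3.7)] -/
theorem structEdges_subset_newConfig : sb.structEdges ⊆ sb.newConfig := fun _ h => Or.inl (Or.inr h)

/-- Stubs are open in the new configuration. [cite: NewmanTassionWu2017, §3.2 (proof of Theorem 3.7)] -/
theorem stubs_subset_newConfig : sb.stubs ⊆ sb.newConfig := fun _ h => Or.inr h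

/-- The stub into `E₁` is open. [cite: NewmanTassionWu2017, §3.2 (proof of Theorem 3.7)] -/
theorem stub₁_mem : s(sb.p₀.getLast sb.hp₀, sb.E₁) ∈ sb.newConfig :=
  sb.stubs_subset_newConfig rfl

/-- A new-open pair at a vertex of `D̄` is a structure edge or the stub. [cite: NewmanTassionWu2017, §3.2 (proof of Theorem 3.7)] -/
theorem edge_at_D {q x : slab 3 k} (h : s(q, x) ∈ sb.newConfig) (hx : planar k x ∈ sb.D) :
    s(q, x) ∈ sb.structEdges ∨ s(q, x) ∈ sb.stubs := by
  rcases h with ((h | h) | h)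
  · exact absurd (mk_mem_touch_iff.2 (Or.inr hx)) h.2
  · exact Or.inl h
  · exact Or.inr h

/-- **Every new-open edge into `D̄` ends at a protected vertex.** [cite: NewmanTassionWu2017, §3.2 (proof of Theorem 3.7)] -/
theorem mem_Wv_of_edge {q x : slab 3 k} (h : s(q, x) ∈ sb.newConfig) (hx : planar k x ∈ sb.D) :
    x ∈ sb.Wv := by
  rcases sb.edge_at_D h hx with h | h
  · exact sb.mem_Wv_of_Sw_D (sb.structEdges_Sw h).2 hx
  · obtain ⟨rfl, -⟩ := sb.stubs_cases_D h hx
    exact Or.inl sb.E₁_mem_SP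

/-- New-open edges into protected vertices come from structure vertices, except the stub into
`E₁`. [cite: NewmanTassionWu2017, §3.2 (proof of Theorem 3.7)] -/
theorem edge_into_Wv {t x : slab 3 k} (h : s(t, x) ∈ sb.newConfig) (hx : x ∈ sb.Wv) :
    t ∈ sb.Sw ∨ x ∈ ({sb.E₁} : Set (slab 3 k)) := by
  have hxD := sb.Wv_D hx
  rcases sb.edge_at_D h hxD with h | h
  · exact Or.inl (sb.structEdges_Sw h).1
  · obtain ⟨rfl, -⟩ := sb.stubs_cases_D h hxD
    exact Or.inr rfl

/-! ### The port vertex and the far side -/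

/-- The port vertex lies in `(R ∖ D)‾`. [cite: NewmanTassionWu2017, §3.2 (proof of Theorem 3.7)] -/
theorem q₁_mem : sb.q₁ ∈ slabLift k (Q.R \ sb.D) := by
  have := sb.hσ
  rw [mem_openConnIn_iff_pathIn] at this
  exact this.left_mem

/-- The port vertex is `ω`-joined to `C̄` inside `R̄`. [cite: NewmanTassionWu2017, §3.2 (proof of Theorem 3.7)] -/
theorem q₁_joined : ω ∈ openConnIn (slabLift k Q.R) sb.q₁ sb.cC :=
  openConnIn_mono (slabLift_mono k (fun _ hx => hx.1)) _ _ sb.hσ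

/-- On `evX`, the port vertex is not `ω`-joined inside `R̄` to any vertex of `Ā`. [cite: NewmanTassionWu2017, §3.2 (proof of Theorem 3.7)] -/
theorem q₁_not_joined (hX : ω ∈ Q.evX k) {a : slab 3 k} (ha : a ∈ slabLift k Q.A)
    (h : ω ∈ openConnIn (slabLift k Q.R) a sb.q₁) : False :=
  Q.not_joined_of_evX hX ha sb.hcC (SlabCriticality.openConnIn_trans h sb.q₁_joined)

/-- On `evX`, the port vertex is off `γ`. [cite: NewmanTassionWu2017, §3.2 (proof of Theorem 3.7)] -/
theorem q₁_not_mem_γ (hX : ω ∈ Q.evX k) : sb.q₁ ∉ Q.γ k ω := fun h =>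
  Q.not_joined_γ_of_evX hX h sb.hcC sb.q₁_joined

/-- Membership in `γ` from membership in `p₀`. [cite: NewmanTassionWu2017, §3.2 (proof of Theorem 3.7)] -/
theorem mem_γ_of_mem_p₀ {x : slab 3 k} (hx : x ∈ sb.p₀) : x ∈ Q.γ k ω := by
  rw [sb.hγ]; exact List.mem_append_left _ hx

/-- `E₁ ∈ γ`. [cite: NewmanTassionWu2017, §3.2 (proof of Theorem 3.7)] -/
theorem E₁_mem_γ : sb.E₁ ∈ Q.γ k ω := by rw [sb.hγ]; simp

/-- Vertices of `p₀` are not structure vertices. [cite: NewmanTassionWu2017, §3.2 (proof of Theorem 3.7)] -/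
theorem p₀_not_Sw (hX : ω ∈ Q.evX k) {x : slab 3 k} (hx : x ∈ sb.p₀) : x ∉ sb.Sw := by
  rintro (h | rfl)
  · exact sb.hp₀D x hx (sb.Wv_D h)
  · exact sb.q₁_not_mem_γ hX (sb.mem_γ_of_mem_p₀ hx)

/-- `γ.head? = some p₀.head`. [cite: NewmanTassionWu2017, §3.2 (proof of Theorem 3.7)] -/
theorem γ_head? : (Q.γ k ω).head? = some (sb.p₀.head sb.hp₀) := by
  rw [sb.hγ, List.head?_append, List.head?_eq_some_head sb.hp₀]; rfl

/-- `p₀.head ∈ Ā`. [cite: NewmanTassionWu2017, §3.2 (proof of Theorem 3.7)] -/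
theorem p₀_head_mem_A (hA : ω ∈ Q.evAB k) : sb.p₀.head sb.hp₀ ∈ slabLift k Q.A := by
  have := (sb.γ_isOSAP hA).head_mem (by simp [sb.hp₀])
  rwa [List.head_append_of_ne_nil sb.hp₀] at this

/-- Vertices of `γ` lie in `S̄`. [cite: NewmanTassionWu2017, §3.2 (proof of Theorem 3.7)] -/
theorem γ_subset_S (hA : ω ∈ Q.evAB k) {x : slab 3 k} (hx : x ∈ Q.γ k ω) : x ∈ slabLift k Q.S :=
  (Q.γ_spec hA).1.subset x hx

/-- Every vertex of `γ` is `ω`-joined inside `R̄` to `p₀.head ∈ Ā`. [cite: NewmanTassionWu2017, §3.2 (proof of Theorem 3.7)] -/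
theorem joined_of_mem_γ (hA : ω ∈ Q.evAB k) {v : slab 3 k} (hv : v ∈ Q.γ k ω) :
    ω ∈ openConnIn (slabLift k Q.R) (sb.p₀.head sb.hp₀) v := by
  have h := Q.joined_head_of_mem_γ hA hv
  have hh : (Q.γ k ω).head (Q.γ_spec hA).1.ne_nil = sb.p₀.head sb.hp₀ := by
    rw [List.head_eq_iff_head?_eq_some, sb.γ_head?]
  rwa [hh] at h

end GlueData.SurgeryB

end SurgeryData

/-! ## The rerouted path and the exchange argument -/

section Exchange

namespace GlueData.SurgeryB

variable {k : ℕ} {Q : GlueData} {ω : BondConfig (slab 3 k)} (sb : Q.SurgeryB k ω)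

/-- The candidate path `T = p₀ ++ E₁ :: P ++ [β]`. [cite: NewmanTassionWu2017, §3.2 (proof of Theorem 3.7, the new minimal path)] -/
def T : List (slab 3 k) := sb.p₀ ++ sb.SP

/-- **`T` is an open self-avoiding path of `ω'` from `Ā` to `B̄` inside `S̄`.**
[cite: NewmanTassionWu2017, §3.2 (proof of Theorem 3.7, "By construction, ω^{(z)} ∈ 𝒳′")] -/
theorem isOSAP_T (hA : ω ∈ Q.evAB k) :
    IsOSAP k sb.newConfig (slabLift k Q.S) (slabLift k Q.A) (slabLift k Q.B) sb.T := by
  have hγO := sb.γ_isOSAP hA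
  have hγnd := hγO.nodup
  rw [List.nodup_append] at hγnd
  obtain ⟨hp₀nd, -, -⟩ := hγnd
  have hγch := hγO.chain
  show IsOSAP k sb.newConfig _ _ _ (sb.p₀ ++ sb.SP)
  refine ⟨?_, ?_, ?_, by simp [sb.hp₀], ?_, ?_⟩
  · -- nodup
    rw [List.nodup_append]
    refine ⟨hp₀nd, sb.hSPnodup, fun a ha b hb hab => ?_⟩
    exact sb.hp₀D a ha (hab ▸ sb.SP_D hb)
  · -- chain
    refine List.IsChain.append ?_ ?_ ?_
    · exact (List.isChain_append.1 hγch).1.imp_of_mem_imp fun a b ha hb h =>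
        ⟨sb.mem_newConfig_of_off h.1 (sb.hp₀D a ha) (sb.hp₀D b hb), h.2⟩
    · exact isChain_of_edgesOf_subset sb.hSPchain
        (fun e he => sb.structEdges_subset_newConfig (Or.inl he))
    · intro x hx y hy
      rw [List.getLast?_eq_some_getLast sb.hp₀, Option.mem_def, Option.some.injEq] at hx
      have : y = sb.E₁ := by
        simp only [SP, List.head?_cons, Option.mem_def, Option.some.injEq] at hy
        exact hy.symm
      subst hx; subst this
      exact ⟨sb.stub₁_mem, (sb.γ_rel_p₀_E₁ hA).2⟩
  · -- inside `S̄`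
    intro x hx
    rcases List.mem_append.1 hx with hx | hx
    · exact γ_subset_S hA (sb.mem_γ_of_mem_p₀ hx)
    · rcases sb.mem_SP_iff.1 hx with rfl | h | rfl
      · exact γ_subset_S hA sb.E₁_mem_γ
      · exact sb.hPS x h
      · exact sb.hβS
  · -- starts in `Ā`
    intro h
    have : (sb.p₀ ++ sb.SP).head h = sb.p₀.head sb.hp₀ := List.head_append_of_ne_nil sb.hp₀
    rw [this]
    exact sb.p₀_head_mem_A hA
  · -- ends in `B̄`
    intro h
    have : (sb.p₀ ++ sb.SP).getLast h = sb.β := by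
      rw [List.getLast_append_of_ne_nil _ (by simp [SP])]; simp [SP]
    rw [this]
    exact sb.hβB

/-- **The minimal path of the new configuration is exactly the rerouted path**:
`Γ_min(ω') = p₀ ++ E₁ :: P ++ [β]` (the tree's exchange lemma `minPath_prefix_of_surgery` gives
`p₀ ++ E₁ :: P ++ [β] ++ tail`; since this prefix already ends in `B̄`, minimality forces
`tail = []`). [cite: NewmanTassionWu2017, §3.2 (proof of Theorem 3.7, "Γ(ω^{(z)}) agrees with Γ(ω) up to u′ … v = v′ = z")] -/
theorem γ_newConfig_eq (hX : ω ∈ Q.evX k) : Q.γ k sb.newConfig = sb.p₀ ++ sb.SP := by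
  have hA := Q.evAB_of_evX hX
  have hS : (slabLift k Q.S).Finite := Q.S_finite
  have hex : ∃ l, IsOSAP k ω (slabLift k Q.S) (slabLift k Q.A) (slabLift k Q.B) l :=
    (mem_slabConn_iff_exists_isOSAP ω _ _ _).1 hA
  have hγ' : minPath k ω (slabLift k Q.S) (slabLift k Q.A) (slabLift k Q.B) =
      (sb.p₀ ++ [sb.E₁]) ++ sb.rest := by
    rw [List.append_assoc]; exact sb.hγ
  have hTO := sb.isOSAP_T hA
  have hT : IsOSAP k sb.newConfig (slabLift k Q.S) (slabLift k Q.A) (slabLift k Q.B)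
      ((sb.p₀ ++ [sb.E₁]) ++ (sb.P ++ [sb.β]) ++ []) := by
    convert hTO using 1
    simp [T, SP]
  have hpfx : ∀ x ∈ (sb.p₀ ++ [sb.E₁]).dropLast, x ∉ sb.Sw := by
    intro x hx
    rw [List.dropLast_concat] at hx
    exact sb.p₀_not_Sw hX hx
  have h2 : ∀ q x, s(q, x) ∈ sb.newConfig → x ∈ sb.Wv →
      x ∉ minPath k ω (slabLift k Q.S) (slabLift k Q.A) (slabLift k Q.B) → q ∈ sb.Sw := by
    intro q x hqx hxW hxγ
    rcases sb.edge_into_Wv hqx hxW with h | h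
    · exact h
    · rw [Set.mem_singleton_iff] at h
      exact absurd (h ▸ sb.E₁_mem_γ) hxγ
  have h4 : ∀ q ∈ sb.Sw, q ∉ sb.Wv →
      q ∉ minPath k ω (slabLift k Q.S) (slabLift k Q.A) (slabLift k Q.B) →
      ∀ x ∈ slabLift k Q.A, ω ∉ openConnIn (slabLift k Q.S) x q := by
    intro q hq hqW _ x hx hj
    have hqw : q = sb.q₁ := by
      rcases hq with h | h
      · exact absurd h hqW
      · exact h
    subst hqw
    exact sb.q₁_not_joined hX hx (openConnIn_mono (slabLift_mono k Q.hSR) _ _ hj)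
  have h5 : ∀ v ∈ sb.Wv, v ∈ slabLift k Q.A →
      v ∈ minPath k ω (slabLift k Q.S) (slabLift k Q.A) (slabLift k Q.B) ∨
      ∀ b ∈ (minPath k ω (slabLift k Q.S) (slabLift k Q.A) (slabLift k Q.B)).head?,
        vKey k b ≤ vKey k v := by
    intro v hvW hvA
    exact absurd hvA (sb.hDA _ (sb.Wv_D hvW))
  have h9 : ∀ x ∈ (sb.P ++ [sb.β]).dropLast, x ∉ slabLift k Q.B := by
    intro x hx
    rw [List.dropLast_concat] at hx
    exact sb.hPB x hx
  have h6 : ∀ (p₁ : List (slab 3 k)) (x y : slab 3 k) (r : List (slab 3 k)),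
      (sb.p₀ ++ [sb.E₁]) ++ (sb.P ++ [sb.β]) = p₁ ++ x :: y :: r →
      (sb.p₀ ++ [sb.E₁]).length ≤ p₁.length + 1 →
      ∀ q, s(x, q) ∈ sb.newConfig → q ≠ y → q ∈ p₁ ∨ vKey k y < vKey k q := by
    intro p₁ x y r heq hlen q hxq hqy
    have heq' : sb.p₀ ++ sb.SP = p₁ ++ x :: y :: r := by
      rw [← heq]; simp [SP]
    have hlen' : sb.p₀.length ≤ p₁.length := by simpa using hlen
    obtain ⟨p₁', hp₁, hSP⟩ : ∃ p₁', p₁ = sb.p₀ ++ p₁' ∧ sb.SP = p₁' ++ x :: y :: r := by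
      rcases List.append_eq_append_iff.1 heq' with ⟨a', hp₁, hSP⟩ | ⟨c', hp₀, hxyr⟩
      · exact ⟨a', hp₁, hSP⟩
      · have : c' = [] := by
          have := congrArg List.length hp₀
          simp only [List.length_append] at this
          exact List.eq_nil_of_length_eq_zero (by omega)
        subst this
        simp only [List.append_nil] at hp₀
        simp only [List.nil_append] at hxyr
        exact ⟨[], by simp [hp₀], by simpa using hxyr.symm⟩
    have hxSP : x ∈ sb.SP := by rw [hSP]; simp
    have hxD : planar k x ∈ sb.D := sb.SP_D hxSP
    have hxq' : s(q, x) ∈ sb.newConfig := by rwa [Sym2.eq_swap]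
    have hcases : s(x, q) ∈ sb.structEdges ∨ s(x, q) ∈ sb.stubs := by
      have := sb.edge_at_D hxq' hxD
      rwa [Sym2.eq_swap] at this
    rcases hcases with (he | he) | he
    · rcases next_of_mem_edgesOf sb.hSPnodup hSP he with ⟨r', hr'⟩ | ⟨l₁', hl₁'⟩
      · exact absurd (List.cons.inj hr').1.symm hqy
      · left
        rw [hp₁, hl₁']
        simp
    · obtain ⟨hxB, hqB⟩ := mem_of_mem_edgesOf he
      have hxc : x = sb.c := by
        rcases List.mem_cons.1 hxB with h | h
        · exact h
        · exact absurd hxSP (sb.BQ_not_SP h)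
      subst hxc
      obtain ⟨l', hl'⟩ := eq_of_mem_edgesOf_head sb.hBnodup he
      right
      have hq : q = sb.BQ.head sb.BQ_ne_nil := by simp [BQ] at hl' ⊢; simp [hl']
      rw [hq]
      exact sb.hfwd p₁' r y hSP
    · have he' : s(q, x) ∈ sb.stubs := by rwa [Sym2.eq_swap]
      obtain ⟨-, rfl⟩ := sb.stubs_cases_D he' hxD
      left
      rw [hp₁]
      exact List.mem_append_left _ (List.getLast_mem _)
  obtain ⟨tail, htail⟩ := minPath_prefix_of_surgery hS hex (sb.p₀ ++ [sb.E₁])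
    sb.rest (sb.P ++ [sb.β]) [] hγ' (by simp) sb.hrest hT
    sb.structEdges sb.Wv sb.Sw (sb.newConfig_subset hA) (fun a b h => sb.structEdges_Sw h)
    hpfx h2 h4 h5 h6 h9
  -- minimality: the prefix `p₀ ++ SP` is itself an open self-avoiding path to `B̄`
  have hμ : Q.γ k sb.newConfig = (sb.p₀ ++ sb.SP) ++ tail := by
    change minPath k sb.newConfig _ _ _ = _
    rw [htail]; simp [SP]
  obtain ⟨-, hmin⟩ := minPath_spec (X := slabLift k Q.A) (Y := slabLift k Q.B) hS ⟨_, hTO⟩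
  by_cases ht : tail = []
  · rw [hμ, ht, List.append_nil]
  · exfalso
    have h1 := hmin _ hTO
    change pathKey k (Q.γ k sb.newConfig) ≤ _ at h1
    rw [hμ] at h1
    exact absurd (pathKey_lt_append (l := sb.p₀ ++ sb.SP) ht) (not_lt.2 h1)

end GlueData.SurgeryB

end Exchange

/-! ## The attachment statistic and the conclusions of the surgery -/

section Attachment

namespace GlueData.SurgeryB

variable {k : ℕ} {Q : GlueData} {ω : BondConfig (slab 3 k)} (sb : Q.SurgeryB k ω)

/-- `Γ_min(ω')` is an open self-avoiding path of `ω'`. [cite: NewmanTassionWu2017, §3.2 (proof of Theorem 3.7)] -/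
theorem μ_isOSAP (hX : ω ∈ Q.evX k) :
    IsOSAP k sb.newConfig (slabLift k Q.S) (slabLift k Q.A) (slabLift k Q.B)
      (Q.γ k sb.newConfig) :=
  (minPath_spec Q.S_finite ⟨_, sb.isOSAP_T (Q.evAB_of_evX hX)⟩).1

/-- The trunk lies in `R̄`. [cite: NewmanTassionWu2017, §3.2 (proof of Theorem 3.7)] -/
theorem SP_subset_R {x : slab 3 k} (hx : x ∈ sb.SP) : x ∈ slabLift k Q.R := sb.hDR (sb.SP_D hx)

/-- The branch lies in `R̄`. [cite: NewmanTassionWu2017, §3.2 (proof of Theorem 3.7)] -/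
theorem Br_subset_R {x : slab 3 k} (hx : x ∈ sb.Br) : x ∈ slabLift k Q.R := sb.hDR (sb.hBrD x hx)

/-- Every vertex of `Γ_min(ω')` off `D̄` lies on `p₀`, hence is `ω`-joined inside `R̄` to
`p₀.head ∈ Ā`. [cite: NewmanTassionWu2017, §3.2 (proof of Theorem 3.7, recovery)] -/
theorem joined_of_mem_μ_not_D (hX : ω ∈ Q.evX k) {q : slab 3 k} (hq : q ∈ Q.γ k sb.newConfig)
    (hqD : planar k q ∉ sb.D) : ω ∈ openConnIn (slabLift k Q.R) (sb.p₀.head sb.hp₀) q := by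
  rw [sb.γ_newConfig_eq hX] at hq
  rcases List.mem_append.1 hq with h | h
  · exact sb.joined_of_mem_γ (Q.evAB_of_evX hX) (sb.mem_γ_of_mem_p₀ h)
  · exact absurd (sb.SP_D h) hqD

/-- On `evX`, the far-side connection from the port vertex avoids `Γ_min(ω')` and is open in
`ω'`. [cite: NewmanTassionWu2017, §3.2 (proof of Theorem 3.7, the path π)] -/
theorem q₁_joined_new (hX : ω ∈ Q.evX k) :
    sb.newConfig ∈ openConnIn (slabLift k Q.R ∩ {v | v ∉ Q.γ k sb.newConfig ∨ v = sb.c})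
      sb.q₁ sb.cC := by
  have hA := Q.evAB_of_evX hX
  have h1 : ω ∈ openConnIn (slabLift k (Q.R \ sb.D) ∩ {v | v ∉ Q.γ k sb.newConfig ∨ v = sb.c})
      sb.q₁ sb.cC := by
    refine openConnIn_inter_of_forall sb.hσ fun v hv hjv => Or.inl fun hvμ => ?_
    have hvD : planar k v ∉ sb.D := hv.2
    have hjA := sb.joined_of_mem_μ_not_D hX hvμ hvD
    have hjC : ω ∈ openConnIn (slabLift k Q.R) v sb.cC :=
      SlabCriticality.openConnIn_trans
        (openConnIn_reverse (openConnIn_mono (slabLift_mono k (fun _ hx => hx.1)) _ _ hjv))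
        sb.q₁_joined
    exact Q.not_joined_of_evX hX (sb.p₀_head_mem_A hA) sb.hcC
      (SlabCriticality.openConnIn_trans hjA hjC)
  have h2 : sb.newConfig ∈ openConnIn
      (slabLift k (Q.R \ sb.D) ∩ {v | v ∉ Q.γ k sb.newConfig ∨ v = sb.c}) sb.q₁ sb.cC :=
    openConnIn_of_subset_on h1 fun a ha b hb hab => sb.mem_newConfig_of_off hab ha.1.2 hb.1.2
  refine openConnIn_mono (fun x hx => ?_) _ _ h2
  exact ⟨slabLift_mono k (fun _ h => h.1) hx.1, hx.2⟩

/-- **The junction is recovered**: `c ∈ att(ω')`. [cite: NewmanTassionWu2017, §3.2 (proof of Theorem 3.7, the recovery sentence)] -/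
theorem c_mem_att (hX : ω ∈ Q.evX k) : sb.c ∈ Q.att k sb.newConfig := by
  have hμ := sb.γ_newConfig_eq hX
  refine ⟨by rw [hμ]; simp [sb.c_mem_SP], sb.cC, sb.hcC, ?_⟩
  set A : Set (slab 3 k) :=
    slabLift k Q.R ∩ {v | v ∉ Q.γ k sb.newConfig ∨ v = sb.c} with hAdef
  have hch : (sb.c :: sb.BQ).IsChain (fun a b => s(a, b) ∈ sb.newConfig ∧ a ≠ b) :=
    isChain_of_edgesOf_subset sb.hBchain
      fun e he => sb.structEdges_subset_newConfig (Or.inr he)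
  have hsub : ∀ x ∈ sb.c :: sb.BQ, x ∈ A := by
    intro x hx
    rcases List.mem_cons.1 hx with rfl | hx
    · exact ⟨sb.SP_subset_R sb.c_mem_SP, Or.inr rfl⟩
    rcases List.mem_append.1 hx with hx | hx
    · refine ⟨sb.Br_subset_R hx, Or.inl fun hμx => ?_⟩
      rw [hμ] at hμx
      rcases List.mem_append.1 hμx with h | h
      · exact sb.hp₀D x h (sb.hBrD x hx)
      · exact sb.hBrSP x hx h
    · rw [List.mem_singleton] at hx
      subst hx
      have := sb.q₁_joined_new hX
      rw [mem_openConnIn_iff_pathIn] at this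
      exact this.left_mem
  have hconn := openConnIn_of_isChain _ _ hch hsub
  have hlast : (sb.c :: sb.BQ).getLast (List.cons_ne_nil _ _) = sb.q₁ := by
    simp [BQ]
  rw [hlast] at hconn
  exact SlabCriticality.openConnIn_trans hconn (sb.q₁_joined_new hX)

/-- **The statistic localises the surgery**: `att(ω') ⊆ D̄`.
[cite: NewmanTassionWu2017, §3.2 (proof of Theorem 3.7, "z is the only site …")] -/
theorem att_subset (hX : ω ∈ Q.evX k) : Q.att k sb.newConfig ⊆ slabLift k sb.D := by
  have hA := Q.evAB_of_evX hX
  have hμ := sb.γ_newConfig_eq hX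
  rintro q ⟨hqμ, c', hc', hj⟩
  by_contra hqD
  rw [mem_slabLift_iff] at hqD
  have hqSw : q ∉ sb.Sw := by
    rintro (h | rfl)
    · exact hqD (sb.Wv_D h)
    · rw [hμ] at hqμ
      rcases List.mem_append.1 hqμ with h | h
      · exact sb.p₀_not_Sw hX h sb.q₁_mem_Sw
      · exact sb.q₁_not_mem_SP h
  have hq0 : ω ∈ openConnIn (slabLift k Q.R) (sb.p₀.head sb.hp₀) q :=
    sb.joined_of_mem_μ_not_D hX hqμ hqD
  have hres := not_mem_structure_of_openConnIn (Reg := slabLift k Q.R)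
    (A := slabLift k Q.R ∩ {v | v ∉ Q.γ k sb.newConfig ∨ v = q})
    (fun x hx => hx.1) sb.structEdges sb.Wv sb.Sw {sb.E₁} sb.Wv_subset
    (sb.p₀.head sb.hp₀) (sb.newConfig_subset hA) (fun a b h => sb.structEdges_Sw h)
    (fun t x h hx => sb.edge_into_Wv h hx) ?_ ?_ hj hqSw hq0
  · exact Q.not_joined_of_evX hX (sb.p₀_head_mem_A hA) hc' hres.2
  · rintro x ⟨-, hx⟩ hK
    rw [Set.mem_singleton_iff] at hK
    subst hK
    exfalso
    rcases hx with hx | hx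
    · exact hx (by rw [hμ]; simp [sb.E₁_mem_SP])
    · exact hqD (hx ▸ sb.hE₁D)
  · intro x hx hxW hj'
    have hxw : x = sb.q₁ := by
      rcases hx with h | h
      · exact absurd h hxW
      · exact h
    subst hxw
    exact sb.q₁_not_joined hX (sb.p₀_head_mem_A hA) hj'

/-- **The new configuration realises `C ⟷^R A`.** [cite: NewmanTassionWu2017, §3.2 (proof of Theorem 3.7, "By construction, ω^{(z)} ∈ 𝒳′")] -/
theorem newConfig_mem_evCA (hX : ω ∈ Q.evX k) : sb.newConfig ∈ Q.evCA k := by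
  have hA := Q.evAB_of_evX hX
  obtain ⟨hcμ, c', hc', hj⟩ := sb.c_mem_att hX
  have hμO := sb.μ_isOSAP hX
  have h1 := hμO.openConnIn_of_mem hcμ
  have hμ := sb.γ_newConfig_eq hX
  have hh : (Q.γ k sb.newConfig).head hμO.ne_nil = sb.p₀.head sb.hp₀ := by
    rw [List.head_eq_iff_head?_eq_some, hμ, List.head?_append, List.head?_eq_some_head sb.hp₀]
    rfl
  rw [hh] at h1
  have h2 : sb.newConfig ∈ openConnIn (slabLift k Q.R) c' (sb.p₀.head sb.hp₀) :=
    openConnIn_reverse (SlabCriticality.openConnIn_trans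
      (openConnIn_mono (slabLift_mono k Q.hSR) _ _ h1) (openConnIn_mono (fun x hx => hx.1) _ _ hj))
  exact ⟨c', hc', sb.p₀.head sb.hp₀, sb.p₀_head_mem_A hA, h2⟩

/-- The attachment statistic of the new configuration is non-empty. [cite: NewmanTassionWu2017, §3.2 (proof of Theorem 3.7)] -/
theorem att_nonempty (hX : ω ∈ Q.evX k) : (Q.att k sb.newConfig).Nonempty := ⟨sb.c, sb.c_mem_att hX⟩

/-- **Recovery window**: `ω` and the new configuration agree off the pairs touching `D̄`.
[cite: NewmanTassionWu2017, §3.2 (proof of Theorem 3.7)] -/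
theorem agree_off_touch {e : Sym2 (slab 3 k)} (he : e ∉ touch k sb.D) : (e ∈ ω ↔ e ∈ sb.newConfig) :=
  (sb.mem_newConfig_iff_of_not_touch he).symm

/-- The new configuration: old edges, or lattice edges inside `R̄` (the window).
[cite: NewmanTassionWu2017, §3.2 (proof of Theorem 3.7, "the number of edges … that can vary is bounded")] -/
theorem mem_window (hA : ω ∈ Q.evAB k) {e : Sym2 (slab 3 k)} (he : e ∈ sb.newConfig) :
    e ∈ ω ∨ (e ∈ (slabGraph 3 k).edgeSet ∧ e ∈ (slabLift k Q.R).sym2) := by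
  rcases sb.newConfig_subset hA he with h | h
  · exact Or.inl h
  · right
    refine ⟨?_, ?_⟩
    · rcases h with h | h
      · exact edgesOf_subset_edgeSet sb.hSPchain h
      · exact edgesOf_subset_edgeSet sb.hBchain h
    · induction e using Sym2.ind with
      | h a b =>
        obtain ⟨ha, hb⟩ := sb.structEdges_Sw h
        have aux : ∀ x ∈ sb.Sw, x ∈ slabLift k Q.R := by
          rintro x (hx | rfl)
          · exact sb.hDR (sb.Wv_D hx)
          · exact slabLift_mono k (fun _ h => h.1) sb.q₁_mem
        exact Set.mk_mem_sym2_iff.2 ⟨aux a ha, aux b hb⟩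

end GlueData.SurgeryB

end Attachment

end NTW17

end Literature.Probability.Percolation
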